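import Literature.NumberTheory.NumberFields.PrincipalIdealTheorem
import Literature.NumberTheory.GaloisRepresentations.IdeleSUnitsRep
import HarnessLib

/-!
# Idelic capitulation in the Hilbert class field: `I_E ⊆ H(E)ˣ · 𝕌_{H(E)} ⊆ H(E)ˣ · J_{H(E),S}`
# (Neukirch VI (7.5), idèle form; the `S`-idèle class group `Cl_S(E)` dies in `H(E)`)

Topic `NumberTheory/NumberFields` (class field theory); namespace `Literature.NumberTheory.NumberFields.hilbertClassField`.
THEOREMS ONLY (no definition, no named fact, no `sorry`, no instance); unconditional.  A thin repackaging of the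
tree's principal ideal theorem (`PrincipalIdealTheorem.lean`, hodge lane: Witt's proof of the group-theoretic
theorem (7.6) + Artin's diagram IV (5.9); `HilbertClassFieldTower.ideleIdealClass_baseChange_eq_one`:
«`[(con x)_f] = 1` in `Cl(H(E))` for every idèle `x` of `E`») in the currency the S-idèle class formation wants.

Brick (A3c-1) of lane «PT3-TC» of cell `bsd-eis` (crux 2 `GoodLatticeBDPValue`, stmt-BirchSwinnertonDyer-19032; lane
owner width seat bsd-line-x1-p1-w8 g9, road memo `PT3TC-ROAD.md`, ORDER OF WORK 2026-08-28T22:59:07Z; this brick by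
width seat -w6 g8): toward `cd_p(G_{K,S}) ≤ 2` for totally complex `K` (NSW (8.3.18) via (8.3.11)), where the exact
sequence `0 → 𝒪_{E,S}ˣ → J_{E,S} → C_E → Cl_S(E) → 0` must lose its last term in the limit over the layers
`E ⊂ K_S`: every `S`-idèle class of `E` dies in the Hilbert class field `H(E)`, which is unramified over `E` at every
finite place and therefore lies inside `K_S` whenever `E` does (placement: the sequel `…CapitulationLayer`).

* `baseChange_mem_principalIdeles_sup_unitIdeles` — for every idèle `x` of the number field `E`,
  `con_{H(E)/E} x ∈ H(E)ˣ · 𝕌_{H(E)}` (`𝕌` = idèles with unit finite components): the class `[(con x)_f] ∈ Cl(H(E))`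
  is trivial (tree), the kernel of `x ↦ [(x_f)]` is `Kˣ · W_1` (`ker_ideleIdealClass`) and `W_1 ≤ 𝕌`
  (`rayUnitIdeles_le_unitIdeles`);
* `baseChange_mem_principalIdeles_sup_ideleS` — hence `con x ∈ H(E)ˣ · J_{H(E),S}` for Tate's `S`-idèles over ANY
  base `F` of `H(E)` and ANY finite `S` (`IdeleCohomology.unitIdeles_le_ideleS`): the `S`-idèle class of `x`
  capitulates in `H(E)`;
* `exists_units_mul_mem_unitIdeles` / `exists_units_mul_mem_ideleS` — the same as factorisations `con x = a · u`.

HONEST FRAMING: bookkeeping over landed theorems; no statement of any Summit is proved; BSD is not advanced by this file.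

## References
* J. Neukirch, *Algebraic Number Theory* (1999), Ch. VI §7 Thm. (7.5) (principal ideal theorem) and §1 Prop. (1.9),
  (1.11) (`C_K/C_K^1 ≅ Cl_K`). [NeukirchANT1999]
* J. Neukirch, A. Schmidt, K. Wingberg, *Cohomology of Number Fields*, 2nd ed. (2008), VIII §3, proof of (8.3.11)
  (`Cl_S(k_S) = 0`). [NeukirchSchmidtWingberg2008]
* J. W. S. Cassels, A. Fröhlich (eds.), *Algebraic Number Theory* (1967), Ch. VII (J. Tate) §7.3 (`J_{L,S}`).
  [CasselsFrohlichANT1967]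
-/

noncomputable section

open NumberField IsDedekindDomain

namespace Literature.NumberTheory.NumberFields.hilbertClassField

open Literature.NumberTheory.GaloisRepresentations

variable (E : Type) [Field E] [NumberField E]

/-- **Idelic principal ideal theorem**: for every idèle `x` of `E`, its conorm in the Hilbert class field lies in
`H(E)ˣ · 𝕌_{H(E)}` — `[(con x)_f] = 1` in `Cl(H(E))` (tree `ideleIdealClass_baseChange_eq_one`), and the kernel of
`x ↦ [(x_f)]` is `H(E)ˣ · W_1 ≤ H(E)ˣ · 𝕌`. [cite: NeukirchANT1999, Ch. VI §7 Thm. (7.5); §1 Prop. (1.11)] -/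
theorem baseChange_mem_principalIdeles_sup_unitIdeles (x : ideleGroup E) :
    Units.map (NumberField.AdeleRing.baseChange E (hilbertClassField E) :
        AdeleRing (𝓞 E) E →* AdeleRing (𝓞 (hilbertClassField E)) (hilbertClassField E)) x ∈
      principalIdeles (hilbertClassField E) ⊔ unitIdeles (hilbertClassField E) := by
  have h1 := HilbertClassFieldTower.ideleIdealClass_baseChange_eq_one E x
  rw [← MonoidHom.mem_ker, ker_ideleIdealClass] at h1
  exact sup_le_sup_left rayUnitIdeles_le_unitIdeles _ h1

/-- The same as a factorisation: `con x = a · u` with `a ∈ H(E)ˣ` (principal idèle) and `u` a unit idèle.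
[cite: NeukirchANT1999, Ch. VI §7 Thm. (7.5)] -/
theorem exists_principalIdeles_mul_unitIdeles_eq_baseChange (x : ideleGroup E) :
    ∃ a ∈ principalIdeles (hilbertClassField E), ∃ u ∈ unitIdeles (hilbertClassField E),
      a * u = Units.map (NumberField.AdeleRing.baseChange E (hilbertClassField E) :
        AdeleRing (𝓞 E) E →* AdeleRing (𝓞 (hilbertClassField E)) (hilbertClassField E)) x :=
  Subgroup.mem_sup.mp (baseChange_mem_principalIdeles_sup_unitIdeles E x)

/-- **`I_E ⊆ H(E)ˣ · J_{H(E),S}`**: for ANY base number field `F` of `H(E)` and ANY finite set `S` of finite places of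
`F`, the conorm of every idèle of `E` lies in `H(E)ˣ · J_{H(E),S}` (Tate's `S`-idèles `IdeleCohomology.ideleS`,
which contain the unit idèles) — the `S`-idèle class of `x` capitulates in the Hilbert class field.
[cite: NeukirchANT1999, Ch. VI §7 Thm. (7.5)] [cite: NeukirchSchmidtWingberg2008, VIII §3 (proof of (8.3.11))]
[cite: CasselsFrohlichANT1967, Ch. VII §7.3] -/
theorem baseChange_mem_principalIdeles_sup_ideleS (F : Type) [Field F] [NumberField F]
    [Algebra F (hilbertClassField E)] (S : Finset (HeightOneSpectrum (𝓞 F))) (x : ideleGroup E) :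
    Units.map (NumberField.AdeleRing.baseChange E (hilbertClassField E) :
        AdeleRing (𝓞 E) E →* AdeleRing (𝓞 (hilbertClassField E)) (hilbertClassField E)) x ∈
      principalIdeles (hilbertClassField E) ⊔ IdeleCohomology.ideleS F (hilbertClassField E) S :=
  sup_le_sup_left IdeleCohomology.unitIdeles_le_ideleS _ (baseChange_mem_principalIdeles_sup_unitIdeles E x)

/-- Factorised form of `baseChange_mem_principalIdeles_sup_ideleS`: `con x = a · u`, `a` principal, `u ∈ J_{H(E),S}`.
[cite: NeukirchANT1999, Ch. VI §7 Thm. (7.5)] [cite: CasselsFrohlichANT1967, Ch. VII §7.3] -/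
theorem exists_principalIdeles_mul_ideleS_eq_baseChange (F : Type) [Field F] [NumberField F]
    [Algebra F (hilbertClassField E)] (S : Finset (HeightOneSpectrum (𝓞 F))) (x : ideleGroup E) :
    ∃ a ∈ principalIdeles (hilbertClassField E), ∃ u ∈ IdeleCohomology.ideleS F (hilbertClassField E) S,
      a * u = Units.map (NumberField.AdeleRing.baseChange E (hilbertClassField E) :
        AdeleRing (𝓞 E) E →* AdeleRing (𝓞 (hilbertClassField E)) (hilbertClassField E)) x :=
  Subgroup.mem_sup.mp (baseChange_mem_principalIdeles_sup_ideleS E F S x)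

end Literature.NumberTheory.NumberFields.hilbertClassField

end
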